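import Summits.PneNP.PneNP.Theorems.Sd2BlMachineLegs
import Summits.PneNP.PneNP.Theorems.SignDeg2SigningLegs
import Summits.PneNP.PneNP.Theorems.LtfLocalAvoidFPMachine
import Summits.PneNP.PneNP.Theorems.LocalMapDecodeFP

/-!
# Sign-degree-2 engine, MACHINE LAYER G2: the raw legs of a `k`-local instance from its code (cell pnp-ideate,
# ROUND-18 item K1'' `SignDeg2Signing.SignDeg2SigningFP`, stage S3)

FRONTIER (range avoidance for sign-degree-≤2 local maps at linear stretch; restricted-model algorithmic
rung); nothing here bears on P vs NP.

The FRONT END of the sign-degree-2 machine, parametric in three COEFFICIENT TABLES `F0 : P ↦ ℤ`,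
`F1 : P ↦ Fin k → ℤ`, `F2 : P ↦ Fin k → Fin k → ℤ` on the `k`-bit tables (the closer feeds the components of
prover-1's `Sd2BlMachine.rowTable₂`, i.e. the rows of the canonical certificate; as machine constants they are
finite tables).  For a table `P`, `krList` lists the (kind, replica) pairs `(κ, r)`, `r < |coefficient of κ|`
(`κ : SignDeg2Legs.Kind k` = bias / slot `i` / ordered slot pair `(i,i')`), and `templatesOf` their LEG TEMPLATES
`(tag, srcSel, role, dstSel, sgn)`: `tag = kindIdx κ + (1+k+k²)·r` (injective, `tag_injective`), `srcSel/dstSel`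
select the constant vertex (`0`) or slot `i` (`i + 1`), `role` = linear-leg bit, `sgn` = negative-coefficient bit.
`certTemplates` is the finite lookup on table blocks; `mkRaw j pos tp` realises a template at output `j` with
positions `pos` as the RAW LEG `(j, tag, ownerCode src, ownerCode dst)` where `ownerCode (v?, b) = 2·(0 | v+1) + b`
will code the owners `SignDeg2Legs.srcOwner / dstOwner : Option (Fin n) × Bool` (companion file); `rawLegs k F0 F1 F2 dec` maps this
over the decoded outputs of prover-1's `LocalMapDecodeFP.decode`.

Proved: tag injectivity, membership / no-duplicates of the template lists, `rawLegs_decode` (on the code of `I` the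
raw legs are the realised templates of `I.table j` at `rowOf I j`, output by output), and the typings
`codeFP_certTemplates`, `codeFP_mkRaw`, `codeFP_rawLegs`, `codeFP_rawLegsDecode`.  The math-side records (the raw
leg `rawOf e` of a certificate leg `e : SignDeg2Legs.CLeg c`, owner codes, membership, no duplicates) are the
companion file `Sd2BlMachineRawLegsDict`.
-/

set_option linter.dupNamespace false -- `Summit.PneNP.PneNP.…`: summit = sub-problem name (D-0017 single-conjunct layout)

namespace Summit.PneNP.PneNP.Theorems.Sd2BlMachine

open Literature.Computability.Complexity CodeFP
open Summit.PneNP.PneNP.Theorems.SfmBlMachine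
open Summit.PneNP.PneNP.Theorems.SignRepCertificate (Cert)
open Summit.PneNP.PneNP.Theorems.SignDeg2Legs
open Summit.PneNP.PneNP.Theorems.LtfLocalAvoidFP (allBits mem_allBits tableOfBits tableOfBits_tabOf)
open Summit.PneNP.PneNP.Theorems.LocalMapDecodeFP (tabOf length_tabOf decode decode_encode outsOf outE codeFP_decode)
open Summit.PneNP.PneNP.Theorems.MajLocalAvoidFP (rowOf getD_rowOf length_rowOf)

/-! ## Kinds: indices, selectors, owner codes -/

/-- A leg template `(tag, srcSel, role, dstSel, sgn)`. -/
abbrev Tmpl := ℕ × ℕ × ℕ × ℕ × ℕ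

/-- The number of kinds `K = 1 + k + k²` (the tag stride). -/
def nKinds (k : ℕ) : ℕ := 1 + k + k * k

/-- The index of a kind: bias `0`, slot `i ↦ 1 + i`, pair `(i,i') ↦ 1 + k + k·i + i'`. -/
def kindIdx (k : ℕ) : Kind k → ℕ
  | Sum.inl _ => 0
  | Sum.inr (Sum.inl i) => 1 + i.val
  | Sum.inr (Sum.inr p) => 1 + k + k * p.1.val + p.2.val

/-- The source selector of a kind (`0` = constant vertex, `i + 1` = slot `i`). -/
def srcSel {k : ℕ} : Kind k → ℕ
  | Sum.inl _ => 0
  | Sum.inr (Sum.inl i) => i.val + 1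
  | Sum.inr (Sum.inr p) => p.1.val + 1

/-- The role bit of a kind (`1` for linear legs). -/
def roleBit {k : ℕ} : Kind k → ℕ
  | Sum.inr (Sum.inl _) => 1
  | _ => 0

/-- The target selector of a kind (`i' + 1` for pair legs `(i,i')`, else the constant vertex `0`). -/
def dstSel {k : ℕ} : Kind k → ℕ
  | Sum.inr (Sum.inr p) => p.2.val + 1
  | _ => 0

/-- The sign bit of a coefficient (`1` iff negative). -/
def sgnBit (c : ℤ) : ℕ := if c < 0 then 1 else 0

/-- Kind indices are below the stride. -/
theorem kindIdx_lt (k : ℕ) (κ : Kind k) : kindIdx k κ < nKinds k := by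
  rcases κ with _ | i | ⟨i, i'⟩
  · simp [kindIdx, nKinds]
  · have := i.isLt
    simp only [kindIdx, nKinds]
    nlinarith
  · have hi := i.isLt; have hi' := i'.isLt
    simp only [kindIdx, nKinds]
    have : k * i.val + i'.val < k * k := by
      calc k * i.val + i'.val < k * i.val + k := by omega
        _ = k * (i.val + 1) := by ring
        _ ≤ k * k := Nat.mul_le_mul_left k (by omega)
    omega

/-- `kindIdx` is injective. -/
theorem kindIdx_injective (k : ℕ) : Function.Injective (kindIdx k) := by
  intro κ κ' h
  rcases κ with u | i | ⟨i, i'⟩ <;> rcases κ' with u' | j | ⟨j, j'⟩ <;> simp only [kindIdx] at h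
  · rfl
  · omega
  · omega
  · omega
  · exact congrArg _ (congrArg _ (Fin.ext (by omega)))
  · exfalso; have := i.isLt; omega
  · omega
  · exfalso; have := j.isLt; omega
  · have hi' := i'.isLt; have hj' := j'.isLt
    have h1 : k * i.val + i'.val = k * j.val + j'.val := by omega
    have hk : 0 < k := by have := i.isLt; omega
    have h2 : i.val = j.val := by
      have q1 : (i'.val + k * i.val) / k = i.val := by
        rw [Nat.add_mul_div_left _ _ hk, Nat.div_eq_of_lt hi', zero_add]
      have q2 : (j'.val + k * j.val) / k = j.val := by
        rw [Nat.add_mul_div_left _ _ hk, Nat.div_eq_of_lt hj', zero_add]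
      rw [← q1, ← q2, add_comm, h1, add_comm]
    have h3 : i'.val = j'.val := by rw [h2] at h1; omega
    exact congrArg _ (congrArg _ (Prod.ext (Fin.ext h2) (Fin.ext h3)))

/-- The tag `kindIdx κ + K·r` determines `(κ, r)`. -/
theorem tag_injective (k : ℕ) {κ κ' : Kind k} {r r' : ℕ}
    (h : kindIdx k κ + nKinds k * r = kindIdx k κ' + nKinds k * r') : κ = κ' ∧ r = r' := by
  have h1 := kindIdx_lt k κ
  have h2 := kindIdx_lt k κ'
  have hK : 0 < nKinds k := by unfold nKinds; omega
  have hr : r = r' := by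
    have q1 : (kindIdx k κ + nKinds k * r) / nKinds k = r := by
      rw [Nat.add_mul_div_left _ _ hK, Nat.div_eq_of_lt h1, zero_add]
    have q2 : (kindIdx k κ' + nKinds k * r') / nKinds k = r' := by
      rw [Nat.add_mul_div_left _ _ hK, Nat.div_eq_of_lt h2, zero_add]
    rw [← q1, ← q2, h]
  subst hr
  exact ⟨kindIdx_injective k (by omega), rfl⟩

/-! ## Kind–replica lists and templates of a table -/

section Tables

variable (k : ℕ) (F0 : ((Fin k → Bool) → Bool) → ℤ) (F1 : ((Fin k → Bool) → Bool) → Fin k → ℤ)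
  (F2 : ((Fin k → Bool) → Bool) → Fin k → Fin k → ℤ)

/-- The coefficient of a kind read off the tables. -/
def coefF (P : (Fin k → Bool) → Bool) : Kind k → ℤ
  | Sum.inl _ => F0 P
  | Sum.inr (Sum.inl i) => F1 P i
  | Sum.inr (Sum.inr p) => F2 P p.1 p.2

/-- A replica bound: the total weight `Σ_κ |coefficient of κ|`. -/
def repBound (P : (Fin k → Bool) → Bool) : ℕ := ∑ κ : Kind k, (coefF k F0 F1 F2 P κ).natAbs

/-- The (kind, replica) pairs of a table: `(κ, r)` with `r < |coefficient of κ|` (some fixed order). -/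
noncomputable def krList (P : (Fin k → Bool) → Bool) : List (Kind k × ℕ) :=
  ((Finset.univ : Finset (Kind k)).toList ×ˢ (List.range (repBound k F0 F1 F2 P))).filter
    fun q => q.2 < (coefF k F0 F1 F2 P q.1).natAbs

/-- The template of a (kind, replica) pair. -/
def tmplKR (P : (Fin k → Bool) → Bool) (q : Kind k × ℕ) : Tmpl :=
  (kindIdx k q.1 + nKinds k * q.2, srcSel q.1, roleBit q.1, dstSel q.1, sgnBit (coefF k F0 F1 F2 P q.1))

/-- ALL LEG TEMPLATES of a table. -/
noncomputable def templatesOf (P : (Fin k → Bool) → Bool) : List Tmpl :=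
  (krList k F0 F1 F2 P).map (tmplKR k F0 F1 F2 P)

/-- Membership in the (kind, replica) list. -/
theorem mem_krList_iff (P : (Fin k → Bool) → Bool) (q : Kind k × ℕ) :
    q ∈ krList k F0 F1 F2 P ↔ q.2 < (coefF k F0 F1 F2 P q.1).natAbs := by
  obtain ⟨κ, r⟩ := q
  unfold krList
  rw [List.mem_filter, List.mem_product, Finset.mem_toList, List.mem_range, decide_eq_true_eq]
  simp only [Finset.mem_univ, true_and]
  constructor
  · exact fun h => h.2
  · intro h
    refine ⟨lt_of_lt_of_le h ?_, h⟩
    exact Finset.single_le_sum (f := fun κ => (coefF k F0 F1 F2 P κ).natAbs) (fun _ _ => Nat.zero_le _)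
      (Finset.mem_univ κ)

/-- The (kind, replica) list has no duplicates. -/
theorem nodup_krList (P : (Fin k → Bool) → Bool) : (krList k F0 F1 F2 P).Nodup :=
  ((Finset.nodup_toList _).product List.nodup_range).filter _

/-- `tmplKR` is injective (the tag determines the pair). -/
theorem tmplKR_injective (P : (Fin k → Bool) → Bool) : Function.Injective (tmplKR k F0 F1 F2 P) := by
  intro q q' h
  have h1 := congrArg Prod.fst h
  simp only [tmplKR] at h1
  obtain ⟨hκ, hr⟩ := tag_injective k h1
  exact Prod.ext hκ hr

/-- The template list has no duplicates. -/
theorem nodup_templatesOf (P : (Fin k → Bool) → Bool) : (templatesOf k F0 F1 F2 P).Nodup :=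
  (nodup_krList k F0 F1 F2 P).map (tmplKR_injective k F0 F1 F2 P)

/-- Membership in the template list. -/
theorem mem_templatesOf_iff (P : (Fin k → Bool) → Bool) (tp : Tmpl) :
    tp ∈ templatesOf k F0 F1 F2 P ↔
      ∃ (κ : Kind k) (r : ℕ), r < (coefF k F0 F1 F2 P κ).natAbs ∧ tmplKR k F0 F1 F2 P (κ, r) = tp := by
  unfold templatesOf
  rw [List.mem_map]
  constructor
  · rintro ⟨⟨κ, r⟩, hq, rfl⟩
    exact ⟨κ, r, (mem_krList_iff k F0 F1 F2 P _).1 hq, rfl⟩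
  · rintro ⟨κ, r, hr, rfl⟩
    exact ⟨(κ, r), (mem_krList_iff k F0 F1 F2 P _).2 hr, rfl⟩

/-- The templates of a table BLOCK (the `2ᵏ` table bits; junk blocks get no legs) — a finite lookup. -/
noncomputable def certTemplates (tab : List Bool) : List Tmpl :=
  if tab ∈ allBits (2 ^ k) then templatesOf k F0 F1 F2 (tableOfBits k tab) else []

/-- On a genuine table block the templates are those of the table. -/
theorem certTemplates_tabOf {n m : ℕ} (I : LocalMap k n m) (j : Fin m) :
    certTemplates k F0 F1 F2 (tabOf I j) = templatesOf k F0 F1 F2 (I.table j) := by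
  rw [certTemplates, if_pos (mem_allBits.2 (length_tabOf I j)), tableOfBits_tabOf]

end Tables

/-! ## Raw legs -/

/-- The vertex code selected by `sel` from the positions `pos`: `0` ↦ the constant vertex (code `0`),
`i + 1` ↦ the variable at slot `i` (code `v + 1`). -/
def selV (pos : List ℕ) (sel : ℕ) : ℕ := if sel = 0 then 0 else pos.getD (sel - 1) 0 + 1

/-- REALISING a template at output `j` with positions `pos`: the raw leg
`(j, tag, 2·srcVertexCode + role, 2·dstVertexCode + sgn)`. -/
def mkRaw (j : ℕ) (pos : List ℕ) (tp : Tmpl) : RLeg :=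
  (j, tp.1, 2 * selV pos tp.2.1 + tp.2.2.1, 2 * selV pos tp.2.2.2.1 + tp.2.2.2.2)

section Raw

variable (k : ℕ) (F0 : ((Fin k → Bool) → Bool) → ℤ) (F1 : ((Fin k → Bool) → Bool) → Fin k → ℤ)
  (F2 : ((Fin k → Bool) → Bool) → Fin k → Fin k → ℤ)

/-- The raw legs of ONE decoded output `(tab, pos)` placed at output index `j`. -/
noncomputable def outRaw (j : ℕ) (o : List Bool × List ℕ) : List RLeg :=
  (certTemplates k F0 F1 F2 o.1).map (mkRaw j o.2)

/-- **THE RAW LEGS** of a decoded instance: output by output, in order. -/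
noncomputable def rawLegs (dec : List (List Bool × List ℕ)) : List RLeg :=
  ((List.range dec.length).map fun j => outRaw k F0 F1 F2 j (dec.getD j ([], []))).flatten

/-- On the decoded code of an instance: the raw legs are the realised templates of the outputs' tables. -/
theorem rawLegs_outsOf {n m : ℕ} (I : LocalMap k n m) :
    rawLegs k F0 F1 F2 (outsOf I)
      = ((List.finRange m).map fun j =>
          (templatesOf k F0 F1 F2 (I.table j)).map (mkRaw j.val (rowOf I j))).flatten := by
  unfold rawLegs
  have hlen : (outsOf I).length = m := by simp [outsOf]
  rw [hlen]
  congr 1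
  rw [← List.map_coe_finRange_eq_range, List.map_map]
  refine List.map_congr_left fun j _ => ?_
  have hget : (outsOf I).getD j.val ([], []) = (tabOf I j, rowOf I j) := by
    rw [List.getD_eq_getElem _ _ (by rw [hlen]; exact j.isLt)]
    simp [outsOf]
  simp only [Function.comp_apply, outRaw, hget, certTemplates_tabOf]

/-- The same on the CODE of the instance (prover-1's `decode_encode`). -/
theorem rawLegs_decode {n m : ℕ} (I : LocalMap k n m) :
    rawLegs k F0 F1 F2 (decode k I.encode)
      = ((List.finRange m).map fun j =>
          (templatesOf k F0 F1 F2 (I.table j)).map (mkRaw j.val (rowOf I j))).flatten := by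
  rw [decode_encode, rawLegs_outsOf]

end Raw

/-! ## Typing in the `CodeFP` algebra -/

section PolyTime

open Polynomial

/-- Code of a template (five binary numerals). -/
abbrev tmplE : Tmpl → List Bool := pairE natE (pairE natE (pairE natE (pairE natE natE)))

variable (k : ℕ) (F0 : ((Fin k → Bool) → Bool) → ℤ) (F1 : ((Fin k → Bool) → Bool) → Fin k → ℤ)
  (F2 : ((Fin k → Bool) → Bool) → Fin k → Fin k → ℤ)

/-- The template table is a finite lookup, hence polynomial time. -/
theorem codeFP_certTemplates : CodeFP strE (rawE tmplE) (certTemplates k F0 F1 F2) := by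
  have he : Function.Injective strE := fun _ _ h => h
  have h := ofList (eα := strE) he (rawE tmplE) (fun tab => templatesOf k F0 F1 F2 (tableOfBits k tab))
    ([] : List Tmpl) (allBits (2 ^ k))
  exact h.congr fun tab => by
    unfold certTemplates
    split_ifs <;> rfl

/-- `selV` is polynomial time. -/
theorem codeFP_selV : CodeFP (pairE (rawE natE) natE) natE (fun p => selV p.1 p.2) := by
  have h0 : CodeFP (pairE (rawE natE) natE) bitE (fun p => decide (p.2 = 0)) :=
    (natEq.comp ((snd _ _).pair (const _ (0 : ℕ)))).congr fun _ => rfl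
  have hget : CodeFP (pairE (rawE natE) natE) natE (fun p => p.1.getD (p.2 - 1) 0 + 1) := by
    have hi : CodeFP (pairE (rawE natE) natE) natE (fun p => p.2 - 1) :=
      (natSub.comp ((snd _ _).pair (const _ (1 : ℕ)))).congr fun _ => rfl
    have hg : CodeFP (pairE (rawE natE) natE) natE (fun p => p.1.getD (p.2 - 1) 0) :=
      ((rawGetOr natE).comp ((fst _ _).pair (hi.pair (const _ (0 : ℕ))))).congr fun _ => rfl
    exact (natAdd.comp (hg.pair (const _ (1 : ℕ)))).congr fun _ => rfl
  exact (h0.ite (const _ (0 : ℕ)) hget).congr fun p => by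
    unfold selV
    by_cases h : p.2 = 0 <;> simp [h]

/-- `mkRaw` is polynomial time (context `(j, pos)`, item a template). -/
theorem codeFP_mkRaw : CodeFP (pairE (pairE natE (rawE natE)) tmplE) rlegE (fun q => mkRaw q.1.1 q.1.2 q.2) := by
  have hpos : CodeFP (pairE (pairE natE (rawE natE)) tmplE) (rawE natE) (fun q => q.1.2) := (fst _ _).snd'
  have hj : CodeFP (pairE (pairE natE (rawE natE)) tmplE) natE (fun q => q.1.1) := (fst _ _).fst'
  have ht : CodeFP (pairE (pairE natE (rawE natE)) tmplE) tmplE (fun q => q.2) := snd _ _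
  have hs1 : CodeFP (pairE (pairE natE (rawE natE)) tmplE) natE (fun q => selV q.1.2 q.2.2.1) :=
    (codeFP_selV.comp (hpos.pair ht.snd'.fst')).congr fun _ => rfl
  have hs2 : CodeFP (pairE (pairE natE (rawE natE)) tmplE) natE (fun q => selV q.1.2 q.2.2.2.2.1) :=
    (codeFP_selV.comp (hpos.pair ht.snd'.snd'.snd'.fst')).congr fun _ => rfl
  have hl : CodeFP (pairE (pairE natE (rawE natE)) tmplE) natE (fun q => 2 * selV q.1.2 q.2.2.1 + q.2.2.2.1) :=
    (natAdd.comp ((natMul.comp ((const _ (2 : ℕ)).pair hs1)).pair ht.snd'.snd'.fst')).congr fun _ => rfl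
  have hr : CodeFP (pairE (pairE natE (rawE natE)) tmplE) natE
      (fun q => 2 * selV q.1.2 q.2.2.2.2.1 + q.2.2.2.2.2) :=
    (natAdd.comp ((natMul.comp ((const _ (2 : ℕ)).pair hs2)).pair ht.snd'.snd'.snd'.snd')).congr fun _ => rfl
  exact (hj.pair (ht.fst'.pair (hl.pair hr))).congr fun _ => rfl

/-- The raw legs of one decoded output are polynomial time (context `j`, item the output). -/
theorem codeFP_outRaw : CodeFP (pairE natE outE) (rawE rlegE) (fun q => outRaw k F0 F1 F2 q.1 q.2) := by
  have htab : CodeFP (pairE natE outE) (rawE tmplE) (fun q => certTemplates k F0 F1 F2 q.2.1) :=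
    (codeFP_certTemplates k F0 F1 F2).comp (snd _ _).fst'
  have hctx : CodeFP (pairE natE outE) (pairE natE (rawE natE)) (fun q => (q.1, q.2.2)) :=
    (fst _ _).pair (snd _ _).snd'
  exact ((map codeFP_mkRaw).comp (hctx.pair htab)).congr fun _ => rfl

/-- Reading decoded output `j` (default `([], [])` past the end). -/
theorem codeFP_getOut : CodeFP (pairE (rawE outE) natE) outE (fun p => p.1.getD p.2 ([], [])) :=
  ((rawGetOr outE).comp ((fst _ _).pair ((snd _ _).pair
    (const (pairE (rawE outE) natE) (eβ := outE) (([] : List Bool), ([] : List ℕ)))))).congr fun _ => rfl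

/-- **G2: the raw legs are computed on decoded codes in polynomial time.** -/
theorem codeFP_rawLegs : CodeFP (rawE outE) (rawE rlegE) (rawLegs k F0 F1 F2) := by
  have hrange : CodeFP (rawE outE) (rawE natE) (fun dec => List.range dec.length) :=
    (urange.comp (ulength outE)).congr fun _ => rfl
  have hitem : CodeFP (pairE (rawE outE) natE) (rawE rlegE)
      (fun p => outRaw k F0 F1 F2 p.2 (p.1.getD p.2 ([], []))) :=
    ((codeFP_outRaw k F0 F1 F2).comp ((snd _ _).pair codeFP_getOut)).congr fun _ => rfl
  exact ((flatten rlegE).comp ((map hitem).comp ((CodeFP.id (rawE outE)).pair hrange))).congr fun _ => rfl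

/-- G2 after prover-1's decoder: from the instance CODE to the raw legs. -/
theorem codeFP_rawLegsDecode : CodeFP strE (rawE rlegE) (fun w => rawLegs k F0 F1 F2 (decode k w)) :=
  (codeFP_rawLegs k F0 F1 F2).comp (codeFP_decode k)

end PolyTime

end Summit.PneNP.PneNP.Theorems.Sd2BlMachine
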